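import Summits.Ventures.HodgeRepro2.InducedTypeSplitting

/-!
# InducedTypeAssembly — the σ-blocks of Lemma B4.4 assembled over all σ

InducedTypeSplitting.lean treats ONE block of the embedding vector `u(x) = (θ(x))_θ` of a
finite separable extension `L/K`: the coordinates at the embeddings `θ : L → ℂ` lying over a
fixed `σ : K → ℂ`.  This file assembles the blocks (T4-B4 Lemma B4.4, «write `Φ̃ = ⊔_{σ ∈ T} Φ̃_σ`
… let `Λ : ℂ^{Φ̃} = ⊕_σ ℂ^{Φ̃_σ} → ⊕_{σ ∈ T} ℂ^r` act as `C_σ⁻¹` on the `σ`-block»):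

* `fibre σ = {θ : θ|_K = σ}`, `inducedSet T = {θ : θ|_K ∈ T} = ⋃_{σ ∈ T} fibre σ`, the fibres are
  pairwise disjoint, and each fibre is `L →ₐ[K] ℂ` for `ℂ` made a `K`-algebra through `σ`
  (`fibreEquivAlgHom`);
* given reindexings `e σ : ι ≃ (L →ₐ[K] ℂ)_σ` (they exist: `exists_reindex`), the map
  `(σ, j) ↦ e σ j` is a bijection `Σ_σ ι ≃ Hom(L, ℂ)` (`indexEquiv`) carrying `{p : p.1 ∈ T}` onto
  `inducedSet T`;
* the ASSEMBLED BLOCK MAP `assembly e b : (Hom(L, ℂ) → ℂ) ≃ₗ[ℂ] (Π σ, ι → ℂ)` — precomposition with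
  `indexEquiv`, currying, then `Λ_σ = (C_σᵀ)⁻¹` on each `σ`-slice — sends the embedding vector of
  `x` to the family of coordinate vectors: `assembly e b (θ ↦ θ x) σ j = σ(x_j)`
  (`assembly_embVec`), and the lattice `u(⊕_j R b_j)` onto the set of families
  `(σ(c_j))_{σ,j}` with `c_j ∈ R` (`image_assembly_latticeOf`).

Restricting the coordinates to `σ ∈ T` gives Lemma B4.4's `Λ(u(𝔪′)) = u_T(O_K)^r`.  The passage
from this linear algebra to complex tori and abelian varieties is cited in B4.4, not formalised.
-/

namespace Summit.Ventures.HodgeRepro2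

section Fibres

variable {K : Type*} [Field K]

/-- The embeddings of `L` extending `σ`, as `K`-algebra homomorphisms for `ℂ` made a `K`-algebra
through `σ` (`σ.toAlgebra`). -/
abbrev ExtHom (L : Type*) [Field L] [Algebra K L] (σ : K →+* ℂ) : Type _ :=
  letI := σ.toAlgebra; L →ₐ[K] ℂ

variable {L : Type*} [Field L] [Algebra K L]

/-- The underlying ring homomorphism of an extension of `σ`. -/
def extToRingHom (σ : K →+* ℂ) (φ : ExtHom L σ) : L →+* ℂ :=
  letI := σ.toAlgebra; φ.toRingHom

/-- `extToRingHom`, pointwise. -/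
theorem extToRingHom_apply (σ : K →+* ℂ) (φ : ExtHom L σ) (x : L) :
    extToRingHom σ φ x = φ x := rfl

/-- The restriction `θ ↦ θ|_K` of an embedding of `L` to `K`. -/
def restrictK (θ : L →+* ℂ) : K →+* ℂ := θ.comp (algebraMap K L)

/-- The induced set `Φ̃ = {θ : L → ℂ : θ|_K ∈ T}` of a set `T` of embeddings of `K`. -/
def inducedSet (T : Set (K →+* ℂ)) : Set (L →+* ℂ) := {θ | restrictK θ ∈ T}

/-- The fibre `Φ̃_σ = {θ : θ|_K = σ}` of the restriction map over `σ`. -/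
def fibre (σ : K →+* ℂ) : Set (L →+* ℂ) := {θ | restrictK θ = σ}

/-- Membership in `inducedSet`, unfolded. -/
theorem mem_inducedSet_iff (T : Set (K →+* ℂ)) (θ : L →+* ℂ) :
    θ ∈ inducedSet T ↔ θ.comp (algebraMap K L) ∈ T := Iff.rfl

/-- Membership in `fibre`, unfolded. -/
theorem mem_fibre_iff (σ : K →+* ℂ) (θ : L →+* ℂ) :
    θ ∈ fibre σ ↔ θ.comp (algebraMap K L) = σ := Iff.rfl

/-- `Φ̃ = ⋃_{σ ∈ T} Φ̃_σ`. -/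
theorem inducedSet_eq_iUnion (T : Set (K →+* ℂ)) :
    inducedSet (L := L) T = ⋃ σ ∈ T, fibre σ := by
  ext θ
  simp only [inducedSet, fibre, Set.mem_setOf_eq, Set.mem_iUnion, exists_prop]
  exact ⟨fun h => ⟨_, h, rfl⟩, fun ⟨_, hσ, h⟩ => h ▸ hσ⟩

/-- The fibres over distinct `σ` are disjoint (the union is a disjoint union). -/
theorem disjoint_fibre {σ σ' : K →+* ℂ} (h : σ ≠ σ') :
    Disjoint (fibre (L := L) σ) (fibre σ') :=
  Set.disjoint_left.2 fun _ h1 h2 => h (h1.symm.trans h2)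

/-- The fibre over `σ` is `L →ₐ[K] ℂ` for the `K`-algebra structure `σ.toAlgebra` on `ℂ`. -/
def fibreEquivAlgHom (σ : K →+* ℂ) : fibre (L := L) σ ≃ ExtHom L σ :=
  letI := σ.toAlgebra
  (Equiv.subtypeEquivRight fun _ => Iff.rfl).trans fibreEquiv

/-- `fibreEquivAlgHom` keeps the underlying map `L → ℂ`. -/
theorem fibreEquivAlgHom_apply_apply (σ : K →+* ℂ) (θ : fibre (L := L) σ) (x : L) :
    fibreEquivAlgHom σ θ x = θ.1 x := rfl

/-- The underlying ring homomorphism of an extension of `σ` lies in the fibre over `σ`. -/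
theorem extToRingHom_mem_fibre (σ : K →+* ℂ) (φ : ExtHom L σ) : extToRingHom σ φ ∈ fibre σ := by
  letI := σ.toAlgebra
  exact φ.comp_algebraMap

/-- `fibreEquivAlgHom` is inverted by taking the underlying ring homomorphism. -/
theorem fibreEquivAlgHom_symm_apply (σ : K →+* ℂ) (φ : ExtHom L σ) :
    ((fibreEquivAlgHom σ).symm φ).1 = extToRingHom σ φ := rfl

end Fibres

section Assembly

variable {ι : Type*} {K L : Type*} [Field K] [Field L] [Algebra K L]

/-- The global index map `(σ, j) ↦ e σ j : Σ_σ ι → Hom(L, ℂ)`. -/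
def indexMap (e : ∀ σ : K →+* ℂ, ι ≃ ExtHom L σ) (p : (_ : K →+* ℂ) × ι) : L →+* ℂ :=
  extToRingHom p.1 (e p.1 p.2)

/-- `indexMap` lands in the fibre over the first coordinate. -/
theorem restrictK_indexMap (e : ∀ σ : K →+* ℂ, ι ≃ ExtHom L σ) (p : (_ : K →+* ℂ) × ι) :
    restrictK (indexMap e p) = p.1 :=
  extToRingHom_mem_fibre p.1 (e p.1 p.2)

/-- `indexMap` is injective. -/
theorem indexMap_injective (e : ∀ σ : K →+* ℂ, ι ≃ ExtHom L σ) :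
    Function.Injective (indexMap e) := by
  rintro ⟨σ, j⟩ ⟨σ', j'⟩ h
  have hσ : σ = σ' := by
    have h1 := restrictK_indexMap e ⟨σ, j⟩
    have h2 := restrictK_indexMap e ⟨σ', j'⟩
    dsimp only at h1 h2
    rw [← h1, ← h2, h]
  subst hσ
  have : e σ j = e σ j' := by
    letI := σ.toAlgebra
    exact AlgHom.ext fun x => RingHom.congr_fun h x
  rw [(e σ).apply_eq_iff_eq] at this
  rw [this]

/-- `indexMap` is surjective: every embedding of `L` extends its own restriction. -/
theorem indexMap_surjective (e : ∀ σ : K →+* ℂ, ι ≃ ExtHom L σ) :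
    Function.Surjective (indexMap e) := by
  intro θ
  refine ⟨⟨restrictK θ, (e _).symm (fibreEquivAlgHom _ ⟨θ, rfl⟩)⟩, ?_⟩
  simp only [indexMap, Equiv.apply_symm_apply]
  rfl

/-- THE INDEX BIJECTION `Σ_σ ι ≃ Hom(L, ℂ)`: the embeddings of `L` are the disjoint union of the
fibres, each indexed by `ι`. -/
noncomputable def indexEquiv (e : ∀ σ : K →+* ℂ, ι ≃ ExtHom L σ) :
    ((_ : K →+* ℂ) × ι) ≃ (L →+* ℂ) :=
  Equiv.ofBijective (indexMap e) ⟨indexMap_injective e, indexMap_surjective e⟩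

/-- `indexEquiv`, unfolded. -/
theorem indexEquiv_apply (e : ∀ σ : K →+* ℂ, ι ≃ ExtHom L σ) (p : (_ : K →+* ℂ) × ι) :
    indexEquiv e p = extToRingHom p.1 (e p.1 p.2) := rfl

/-- `indexEquiv` carries `{p : p.1 ∈ T}` onto `inducedSet T = ⊔_{σ ∈ T} Φ̃_σ`. -/
theorem indexEquiv_mem_inducedSet_iff (e : ∀ σ : K →+* ℂ, ι ≃ ExtHom L σ) (T : Set (K →+* ℂ))
    (p : (_ : K →+* ℂ) × ι) : indexEquiv e p ∈ inducedSet T ↔ p.1 ∈ T := by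
  change restrictK (indexMap e p) ∈ T ↔ p.1 ∈ T
  rw [restrictK_indexMap]

variable [Fintype ι] [Module.Finite K L] [Algebra.IsSeparable K L]

/-- Every fibre can be indexed by the basis index set `ι` (each `σ` has `[L : K]` extensions). -/
theorem exists_reindex (b : Module.Basis ι K L) :
    ∀ σ : K →+* ℂ, Nonempty (ι ≃ ExtHom L σ) := fun σ =>
  letI := σ.toAlgebra
  exists_equiv_algHom K ℂ b

variable [DecidableEq ι]

/-- THE ASSEMBLED BLOCK MAP `Λ : ℂ^{Hom(L,ℂ)} ≃ Π_σ ℂ^ι`: precompose with `indexEquiv`, curry, and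
apply `Λ_σ = (C_σᵀ)⁻¹` on the `σ`-slice. -/
noncomputable def assembly (e : ∀ σ : K →+* ℂ, ι ≃ ExtHom L σ) (b : Module.Basis ι K L) :
    ((L →+* ℂ) → ℂ) ≃ₗ[ℂ] ((σ : K →+* ℂ) → ι → ℂ) :=
  (LinearEquiv.funCongrLeft ℂ ℂ (indexEquiv e)).trans
    ((LinearEquiv.piCurry ℂ (fun (_ : K →+* ℂ) (_ : ι) => ℂ)).trans
      (LinearEquiv.piCongrRight fun σ =>
        letI := σ.toAlgebra
        blockEquiv b (e σ)))

/-- The embedding vector `u(x) = (θ(x))_θ`. -/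
def embVec (x : L) : (L →+* ℂ) → ℂ := fun θ => θ x

/-- `Λ(u(x)) = ((σ(x_j))_j)_σ`: the assembled block map turns the embedding vector of `x` into
the family of its `σ`-coordinate vectors (Lemma B4.4: `Λ(u(x)) = (u_T(x_1), …, u_T(x_r))`). -/
theorem assembly_embVec (e : ∀ σ : K →+* ℂ, ι ≃ ExtHom L σ) (b : Module.Basis ι K L) (x : L)
    (σ : K →+* ℂ) (j : ι) : assembly e b (embVec x) σ j = σ (b.repr x j) := by
  letI := σ.toAlgebra
  have h : (fun j' => embVec x (indexEquiv e ⟨σ, j'⟩)) = fibreVec (e σ) x := by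
    funext j'
    rfl
  change (blockEquiv b (e σ)) (fun j' => embVec x (indexEquiv e ⟨σ, j'⟩)) j = _
  rw [h, blockEquiv_fibreVec, coordVec_apply]
  rfl

/-- `Λ(u(⊕_j R b_j))` is the set of families `(σ(c_j))_{σ, j}` with `c_j ∈ R` (Lemma B4.4:
`Λ(u(𝔪′)) = u_T(O_K)^r` — the same `r` coordinates `c_j ∈ O_K` seen through every `σ`). -/
theorem image_assembly_latticeOf (e : ∀ σ : K →+* ℂ, ι ≃ ExtHom L σ) (b : Module.Basis ι K L)
    (R : Set K) :
    (fun x => assembly e b (embVec x)) '' latticeOf b R =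
      {v | ∃ c : ι → K, (∀ j, c j ∈ R) ∧ ∀ (σ : K →+* ℂ) (j : ι), v σ j = σ (c j)} := by
  ext v
  constructor
  · rintro ⟨x, hx, rfl⟩
    exact ⟨fun j => b.repr x j, hx, fun σ j => assembly_embVec e b x σ j⟩
  · rintro ⟨c, hc, hv⟩
    refine ⟨∑ j, c j • b j, sum_smul_mem_latticeOf b R c hc, ?_⟩
    funext σ j
    show assembly e b (embVec _) σ j = v σ j
    rw [assembly_embVec, b.repr_sum_self, hv]

end Assembly

end Summit.Ventures.HodgeRepro2
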